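import Literature.NumberTheory.GaloisRepresentations.QuarticTwistGrossencharakterRamification
import HarnessLib

/-!
# The Größencharakter `χ_D(𝔭) = \overline{(D/π)₄} π` of `y² = x³ − Dx` is ramified above every prime of `2D`:
# the witnesses above the odd primes of `D` (biquadratic reciprocity, Prop. 9.9.8)

Topic `NumberTheory/GaloisRepresentations`; namespace `Literature.NumberTheory.GaloisRepresentations`.  THEOREMS ONLY
(no definition, no named fact, no `sorry`).  Sequel of `QuarticTwistGrossencharakterRamification` (§§1–4: the ideal character
`χ̃_D((b)) = e((D/(b))₄³ b̃)`, the witness above `2`).  Here, for an odd prime `p` with `p^e ∥ D`, `1 ≤ e ≤ 3` (`D` free of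
fourth powers; the additive fibres `III, I₀*, III*` of `E_D : y² = x³ − Dx`) and a prime `𝔭_w ∋ p` of `ℤ[i]`:

* §5 `exists_quarticTwist_witness_of_factorisation` — the common step: with `(8D) = J · 𝔭_w^e`, `J ≤ (8m)` (`m = D/p^e`),
  choose `a ≡ 1 (mod J)`, `a ≡ x (mod 𝔭_w)` where `χ_w(x) = ζ` (CRT); then `a` is primary, prime to `8D`, and
  `(D/(a))₄ = (p/(a))₄^e · (m/(a))₄ = ζ^e` («`α ≡ 1 (8D₀) ⇒ (D₀/α)₄ = 1`»), so `χ̃_D((a)) = ζ^{3e} a ≠ a`;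
  `exists_quarticTwist_witness_inert` (`p ≡ 3 (4)`, `𝔭_w = (p)`: `(p/(a))₄ = (−1/(a))₄ (−p/(a))₄ = (a/p)₄` by Prop. 9.9.8 for
  `−p ≡ 1 (4)`), `exists_quarticTwist_witness_split` (`p ≡ 1 (4)`, `p = π₁π₂`, `𝔭_w = (π₁)`, `a ≡ 1 (mod π₂^e)`:
  `(p/(a))₄ = (a/π₁)₄ (a/π₂)₄ = ζ · 1` by Prop. 9.9.8 for `p ≡ 1 (4)`);
* §6 ★★ `exists_quarticTwist_witness` — **for EVERY prime `𝔭_w ∣ 2D` (`D ≠ 0`, `p⁴ ∤ D`) a ramification witness**: an integer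
  `a ∉ 𝔭_w`, prime to `8D`, `≡ 1` modulo the prime-power factors of `(8D)` away from `𝔭_w`, with `χ̃_D((a)) ≠ e(a)` — so
  `heckeOfGross` of `χ_D` is RAMIFIED at `𝔭_w` (`not_isUnramifiedAt_heckeOfGross_of_ne`): Ireland–Rosen's «if `P` divides
  `2D` define `χ(P) = 0`» in the idelic dictionary (the conductor of `χ_D` is divisible by every prime of `2D`).

Nothing about BSD is proved here; the Hecke-character / `L`-function assembly is `EllipticCurves/QuarticTwistDeuringCore`.

## References
* K. Ireland, M. Rosen, *A Classical Introduction to Modern Number Theory* (1982), Ch. 18 §6, Theorem 7 and its proof;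
  Ch. 9 §8 Prop. 9.8.3, §9 Props. 9.9.6–9.9.8. [IrelandRosen1982]
* J. Neukirch, *Algebraic Number Theory* (1999), Ch. VII §6 (6.13)–(6.14). [NeukirchANT1999]
* J. H. Silverman, *Advanced Topics in the Arithmetic of Elliptic Curves* (1994), II Thm. 9.2, Thm. 10.5. [SilvermanATAEC1994]

## Mathlib / tree search
Tree: `quarticSymbol_span_intCast_primary_comm` (Prop. 9.9.8, `BiquadraticReciprocityRationalInteger`),
`quarticSymbol_span_intCast_eq_one_of_sub_one_mem_span'` (`BiquadraticReciprocitySupplement`), `quarticSymbol_span_neg_one_eq_one_of_sub_one_mem_span_eight`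
(`QuarticSymbolModulus`), `quarticSymbol_mul_right`, `quarticSymbol_pow_right`, `quarticSymbol_mul`, `quarticSymbol_asIdeal`, `quarticSymbol_span_neg`,
`prime_natCast_of_mod_four_eq_three`, `eq_span_natCast_of_mem_of_mod_four_eq_three` (`CyclotomicFieldFourPrimes`),
`exists_prime_eq_mul_galRestrict_of_mod_four_eq_one`, `exists_algEquiv_ne_one_four` (`CyclotomicFieldFourNormConjugation`);
§§1–4 of `QuarticTwistGrossencharakterRamification`.  Mathlib: `Prime.coprime_iff_not_dvd`, `Nat.exists_eq_pow_mul_and_not_dvd`,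
`Ideal.IsMaximal.coprime_of_ne`, `IsPrimitiveRoot.pow_eq_one_iff_dvd`.
-/

noncomputable section

namespace Literature.NumberTheory.GaloisRepresentations

open NumberField IsDedekindDomain Literature.NumberTheory.NumberFields
open scoped ComplexConjugate Pointwise

variable {K : Type} [Field K] [NumberField K] [IsCyclotomicExtension {4} ℚ K]
variable {ζ : 𝓞 K} (hζ : IsPrimitiveRoot ζ 4)

/-! ### §5 The ramification witnesses above the odd primes of `D` -/

section WitnessOdd

variable [IsPrincipalIdealRing (𝓞 K)]

omit [NumberField K] [IsCyclotomicExtension {4} ℚ K] [IsPrincipalIdealRing (𝓞 K)] in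
/-- `D = p^e · m` with `p ∤ m`, for `D ≠ 0`. [folklore] -/
private theorem int_exists_eq_pow_mul_not_dvd {D : ℤ} (hD : D ≠ 0) {p : ℕ} (hp : p.Prime) :
    ∃ (e : ℕ) (m : ℤ), D = (p : ℤ) ^ e * m ∧ ¬ (p : ℤ) ∣ m := by
  obtain ⟨e, n', hn', hDn⟩ := Nat.exists_eq_pow_mul_and_not_dvd (Int.natAbs_ne_zero.mpr hD) p hp.ne_one
  have hn'' : ¬ (p : ℤ) ∣ (n' : ℤ) := by exact_mod_cast hn'
  rcases Int.natAbs_eq D with h | h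
  · refine ⟨e, n', ?_, hn''⟩
    conv_lhs => rw [h, hDn]
    push_cast; ring
  · refine ⟨e, -n', ?_, by rwa [dvd_neg]⟩
    conv_lhs => rw [h, hDn]
    push_cast; ring

omit [NumberField K] [IsCyclotomicExtension {4} ℚ K] [IsPrincipalIdealRing (𝓞 K)] in
/-- For `p ∣ D`, `p⁴ ∤ D`: the exact power `p^e ∥ D` has `1 ≤ e ≤ 3` (`D` fourth-power-free at `p`; the additive fibres
`III, I₀*, III*` of `y² = x³ − Dx`). [cite: IrelandRosen1982, Ch. 18 §6, Theorem 7] -/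
theorem exponent_mem_of_dvd_of_not_pow_four_dvd {D m : ℤ} {p e : ℕ} (hDe : D = (p : ℤ) ^ e * m)
    (hpm : ¬ (p : ℤ) ∣ m) (hpD : (p : ℤ) ∣ D) (hD4 : ¬ (p : ℤ) ^ 4 ∣ D) : 1 ≤ e ∧ e ≤ 3 := by
  constructor
  · by_contra h0
    have : e = 0 := by omega
    subst this
    rw [pow_zero, one_mul] at hDe
    exact hpm (hDe ▸ hpD)
  · by_contra h4
    apply hD4
    rw [hDe]
    exact (pow_dvd_pow _ (by omega)).mul_right m

omit [IsCyclotomicExtension {4} ℚ K] [IsPrincipalIdealRing (𝓞 K)] in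
/-- `(8m) + 𝔭_w = 1` for a prime `𝔭_w ∋ p`, `p` an odd prime not dividing `m`. [folklore] -/
private theorem isCoprime_span_eight_mul_asIdeal {m : ℤ} {p : ℕ} (hp : p.Prime) (hp2 : p ≠ 2) (hpm : ¬ (p : ℤ) ∣ m)
    {w : HeightOneSpectrum (𝓞 K)} (hw : (p : 𝓞 K) ∈ w.asIdeal) :
    IsCoprime (Ideal.span {((8 * m : ℤ) : 𝓞 K)}) w.asIdeal := by
  have hpZ : Prime (p : ℤ) := Nat.prime_iff_prime_int.mp hp
  have h8 : ¬ (p : ℤ) ∣ 8 := fun h => by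
    have h' : p ∣ 2 ^ 3 := by exact_mod_cast h
    exact hp2 ((Nat.prime_dvd_prime_iff_eq hp Nat.prime_two).mp (hp.dvd_of_dvd_pow h'))
  have hcop : IsCoprime (8 * m : ℤ) p :=
    (((Prime.coprime_iff_not_dvd hpZ).mpr h8).mul_right ((Prime.coprime_iff_not_dvd hpZ).mpr hpm)).symm
  obtain ⟨u, v, huv⟩ := hcop
  refine Ideal.isCoprime_iff_exists.mpr ⟨(u : 𝓞 K) * ((8 * m : ℤ) : 𝓞 K), Ideal.mul_mem_left _ _
    (Ideal.mem_span_singleton_self _), (v : 𝓞 K) * (p : 𝓞 K), w.asIdeal.mul_mem_left _ hw, ?_⟩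
  exact_mod_cast congrArg (Int.cast : ℤ → 𝓞 K) huv

include hζ

/-- **The common step of the odd witnesses.**  Let `D = p^e m`, `1 ≤ e ≤ 3`, `m ≠ 0`, `𝔭_w ∌ 2` a prime, `J ≤ (8m)` an
ideal prime to `𝔭_w` with `(8D) = J · 𝔭_w^e`, and suppose `(p/(a))₄ = χ_w(a)` for every `a ≡ 1 (mod J)`, `a ∉ 𝔭_w`.
Choose `x` with `χ_w(x) = ζ` and `a ≡ 1 (mod J)`, `a ≡ x (mod 𝔭_w)` (CRT).  Then `a` is primary, prime to `8D`, and
`(D/(a))₄ = (p/(a))₄^e (m/(a))₄ = ζ^e` («`α ≡ 1 (8m) ⇒ (m/α)₄ = 1`»), so `χ̃_D((a)) = ζ^{3e} a ≠ a`.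
[cite: IrelandRosen1982, Ch. 18 §6, Theorem 7 (proof); Ch. 9 §8 Prop. 9.8.3] -/
theorem exists_quarticTwist_witness_of_factorisation (e : K →+* ℂ) {D m : ℤ} {p k : ℕ} (hm0 : m ≠ 0)
    (hDk : D = (p : ℤ) ^ k * m) (hk1 : 1 ≤ k) (hk3 : k ≤ 3)
    {w : HeightOneSpectrum (𝓞 K)} (h2w : (2 : 𝓞 K) ∉ w.asIdeal) {J : Ideal (𝓞 K)}
    (hJ8 : J ≤ Ideal.span {((8 * m : ℤ) : 𝓞 K)}) (hJw : IsCoprime J w.asIdeal)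
    (h𝔣 : Ideal.span {((8 * D : ℤ) : 𝓞 K)} = J * w.asIdeal ^ k)
    (hval : ∀ a : 𝓞 K, a - 1 ∈ J → a ∉ w.asIdeal →
      quarticSymbol (Ideal.span {a}) (p : 𝓞 K) = quarticResidueSymbol w (Ideal.Quotient.mk w.asIdeal a)) :
    ∃ a : 𝓞 K, a ≠ 0 ∧ a ∉ w.asIdeal ∧ IsCoprime (Ideal.span {a}) (Ideal.span {((8 * D : ℤ) : 𝓞 K)}) ∧
      (∀ v : HeightOneSpectrum (𝓞 K), v ≠ w → modulusExp (Ideal.span {((8 * D : ℤ) : 𝓞 K)}) v ≠ 0 →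
        a - 1 ∈ v.asIdeal ^ modulusExp (Ideal.span {((8 * D : ℤ) : 𝓞 K)}) v) ∧
      LFunctions.idealPow K
          (fun v => (e (quarticResidueSymbol v (Ideal.Quotient.mk v.asIdeal (D : 𝓞 K)) ^ 3) : ℂ) *
            e (primaryGen (exists_units_mul_sub_one_mem_span_four hζ) v)) (Ideal.span {a}) ≠ e (a : K) := by
  classical
  obtain ⟨x, hx⟩ := exists_quarticResidueSymbol_eq hζ h2w
  obtain ⟨α, hα, β, hβ, hαβ⟩ := Ideal.isCoprime_iff_exists.mp hJw
  set a : 𝓞 K := β + α * x with ha_def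
  have ha1 : a - 1 ∈ J := by
    have : a - 1 = α * (x - 1) := by rw [ha_def]; linear_combination hαβ
    rw [this]; exact J.mul_mem_right _ hα
  have hax : a - x ∈ w.asIdeal := by
    have : a - x = β * (1 - x) := by rw [ha_def]; linear_combination x * hαβ
    rw [this]; exact w.asIdeal.mul_mem_right _ hβ
  have hχa : quarticResidueSymbol w (Ideal.Quotient.mk w.asIdeal a) = ζ := by
    rw [quarticResidueSymbol_mk_eq_mk_of_sub_mem w hax, hx]
  have haw : a ∉ w.asIdeal := by
    intro h
    have h0 : Ideal.Quotient.mk w.asIdeal a = 0 := Ideal.Quotient.eq_zero_iff_mem.mpr h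
    rw [h0, quarticResidueSymbol_zero hζ] at hχa
    exact hζ.ne_zero (by norm_num) hχa.symm
  have ha0 : a ≠ 0 := fun h => haw (h ▸ w.asIdeal.zero_mem)
  have ha4 : a - 1 ∈ Ideal.span {(2 + 2 * ζ : 𝓞 K)} := QuarticTwistDatum.span_le_span_two_add hζ m (hJ8 ha1)
  have hcop4 : IsCoprime (Ideal.span {a}) (Ideal.span {(2 + 2 * ζ : 𝓞 K)}) :=
    isCoprime_span_singleton_of_sub_one_mem ha4
  refine ⟨a, ha0, haw, ?_, fun v hv _ => ?_, ?_⟩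
  · rw [h𝔣]
    exact (isCoprime_span_singleton_of_sub_one_mem ha1).mul_right
      (isCoprime_span_singleton_asIdeal_of_not_mem haw).pow_right
  · exact sub_one_mem_pow_modulusExp_of_dvd (dvd_of_eq h𝔣) (fun v' hv' => heightOneSpectrum_eq_of_dvd_pow hv') ha1 hv
  · have hsurj := exists_units_mul_sub_one_mem_span_four hζ
    have hinj := units_eq_one_of_sub_one_mem_span_four hζ
    have hprim : primarize hsurj a = a := primarize_eq_of hsurj hinj hcop4 rfl ha4
    have h2v : ∀ v : HeightOneSpectrum (𝓞 K), Ideal.span {a} ≤ v.asIdeal → (2 : 𝓞 K) ∉ v.asIdeal := fun v hv =>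
      two_not_mem_of_mem_of_sub_one_mem_span ((Ideal.span_singleton_le_iff_mem _).mp hv) ha4
    have hm1 : quarticSymbol (Ideal.span {a}) (m : 𝓞 K) = 1 :=
      quarticSymbol_span_intCast_eq_one_of_sub_one_mem_span' hζ hm0 (hJ8 ha1)
    have hsym : quarticSymbol (Ideal.span {a}) (D : 𝓞 K) = ζ ^ k := by
      rw [hDk]
      push_cast
      rw [quarticSymbol_mul_right hζ, quarticSymbol_pow_right hζ h2v, hval a ha1 haw, hχa, hm1, mul_one]
    rw [idealPow_quarticTwist_span hζ e D ha0 hcop4, hsym, hprim, ← map_pow, ← map_mul]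
    intro h
    have h' : ((ζ ^ k) ^ 3 * a : 𝓞 K) = a := by
      have h1 := e.injective h
      exact RingOfIntegers.ext (by push_cast; exact h1)
    have h1 : ζ ^ (k * 3) = 1 := by
      rw [pow_mul]
      exact mul_right_cancel₀ ha0 (by rw [h', one_mul])
    have hdvd := (hζ.pow_eq_one_iff_dvd (k * 3)).mp h1
    omega

/-- **Ramification witness above an inert prime `p ≡ 3 (4)` of `D`** (`p^e ∥ D`, `1 ≤ e ≤ 3`, `𝔭_w = (p)`): an integer
`a ≡ 1 (mod 8m)`, `m = D/p^e`, with `χ_{(p)}(a) = ζ`, so that `(D/(a))₄ = (a/p)₄^e · 1 = ζ^e` by Prop. 9.9.8 for `−p ≡ 1 (4)`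
and `(−1/(a))₄ = 1`; hence `χ̃_D((a)) = ζ^{3e} a ≠ a` on a local unit at `(p)` of the ray modulo `(8D)`.
[cite: IrelandRosen1982, Ch. 18 §6, Theorem 7; Ch. 9 §9, Props. 9.9.6, 9.9.8] -/
theorem exists_quarticTwist_witness_inert (e : K →+* ℂ) {D : ℤ} (hD : D ≠ 0) {p : ℕ} (hp : p.Prime)
    (hp3 : p % 4 = 3) (hpD : (p : ℤ) ∣ D) (hD4 : ¬ (p : ℤ) ^ 4 ∣ D) {w : HeightOneSpectrum (𝓞 K)}
    (hw : (p : 𝓞 K) ∈ w.asIdeal) :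
    ∃ a : 𝓞 K, a ≠ 0 ∧ a ∉ w.asIdeal ∧ IsCoprime (Ideal.span {a}) (Ideal.span {((8 * D : ℤ) : 𝓞 K)}) ∧
      (∀ v : HeightOneSpectrum (𝓞 K), v ≠ w → modulusExp (Ideal.span {((8 * D : ℤ) : 𝓞 K)}) v ≠ 0 →
        a - 1 ∈ v.asIdeal ^ modulusExp (Ideal.span {((8 * D : ℤ) : 𝓞 K)}) v) ∧
      LFunctions.idealPow K
          (fun v => (e (quarticResidueSymbol v (Ideal.Quotient.mk v.asIdeal (D : 𝓞 K)) ^ 3) : ℂ) *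
            e (primaryGen (exists_units_mul_sub_one_mem_span_four hζ) v)) (Ideal.span {a}) ≠ e (a : K) := by
  classical
  obtain ⟨k, m, hDk, hpm⟩ := int_exists_eq_pow_mul_not_dvd hD hp
  obtain ⟨hk1, hk3⟩ := exponent_mem_of_dvd_of_not_pow_four_dvd hDk hpm hpD hD4
  have hm0 : m ≠ 0 := fun h => hD (by rw [hDk, h, mul_zero])
  have hp2 : p ≠ 2 := by rintro rfl; norm_num at hp3
  have h2w := two_not_mem_of_natCast_mem_of_ne_two hp hp2 hw
  have hwP : w.asIdeal = Ideal.span {(p : 𝓞 K)} := eq_span_natCast_of_mem_of_mod_four_eq_three hp hp3 w.isPrime hw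
  refine exists_quarticTwist_witness_of_factorisation hζ e hm0 hDk hk1 hk3 h2w
    (J := Ideal.span {((8 * m : ℤ) : 𝓞 K)}) le_rfl (isCoprime_span_eight_mul_asIdeal hp hp2 hpm hw) ?_ ?_
  · rw [hwP, Ideal.span_singleton_pow, Ideal.span_singleton_mul_span_singleton, hDk]
    congr 1; push_cast; ring
  · intro a ha1 haw
    have ha8 : a - 1 ∈ Ideal.span {(8 : 𝓞 K)} :=
      Ideal.span_singleton_le_span_singleton.mpr ⟨(m : 𝓞 K), by push_cast; ring⟩ ha1
    have ha4 : a - 1 ∈ Ideal.span {(2 + 2 * ζ : 𝓞 K)} := QuarticTwistDatum.span_le_span_two_add hζ m ha1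
    have hprime : Prime (p : 𝓞 K) := prime_natCast_of_mod_four_eq_three hp hp3
    have hcop : IsCoprime a (p : 𝓞 K) :=
      ((Prime.coprime_iff_not_dvd hprime).mpr fun h => haw (hwP ▸ Ideal.mem_span_singleton.mpr h)).symm
    have hneg1 : quarticSymbol (Ideal.span {a}) (-1 : 𝓞 K) = 1 :=
      quarticSymbol_span_neg_one_eq_one_of_sub_one_mem_span_eight hζ ha8
    have hrec := quarticSymbol_span_intCast_primary_comm hζ (a := -(p : ℤ)) (by omega) ha4
      (by push_cast; exact hcop.neg_right)
    push_cast at hrec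
    calc quarticSymbol (Ideal.span {a}) (p : 𝓞 K)
        = quarticSymbol (Ideal.span {a}) ((-1) * (-(p : 𝓞 K))) := by rw [neg_one_mul, neg_neg]
      _ = quarticSymbol (Ideal.span {-(p : 𝓞 K)}) a := by rw [quarticSymbol_mul_right hζ, hneg1, one_mul, hrec]
      _ = quarticResidueSymbol w (Ideal.Quotient.mk w.asIdeal a) := by
          rw [quarticSymbol_span_neg, ← hwP, quarticSymbol_asIdeal]

/-- **Ramification witness above a split prime `p ≡ 1 (4)` of `D`** (`p = π₁π₂`, `𝔭_w = (π₁) ≠ (π₂)`, `p^e ∥ D`,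
`1 ≤ e ≤ 3`): an integer `a ≡ 1 (mod 8m · π₂^e)`, `m = D/p^e`, with `χ_{π₁}(a) = ζ`; then `(D/(a))₄ = ((a/π₁)₄ (a/π₂)₄)^e
· 1 = ζ^e` by Prop. 9.9.8 for `p ≡ 1 (4)`, and `χ̃_D((a)) = ζ^{3e} a ≠ a` on a local unit at `(π₁)` of the ray
modulo `(8D)`. [cite: IrelandRosen1982, Ch. 18 §6, Theorem 7; Ch. 9 §9, Props. 9.9.7, 9.9.8] -/
theorem exists_quarticTwist_witness_split (e : K →+* ℂ) {D : ℤ} (hD : D ≠ 0) {p : ℕ} (hp : p.Prime)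
    (hp1 : p % 4 = 1) (hpD : (p : ℤ) ∣ D) (hD4 : ¬ (p : ℤ) ^ 4 ∣ D) {w : HeightOneSpectrum (𝓞 K)}
    (hw : (p : 𝓞 K) ∈ w.asIdeal) :
    ∃ a : 𝓞 K, a ≠ 0 ∧ a ∉ w.asIdeal ∧ IsCoprime (Ideal.span {a}) (Ideal.span {((8 * D : ℤ) : 𝓞 K)}) ∧
      (∀ v : HeightOneSpectrum (𝓞 K), v ≠ w → modulusExp (Ideal.span {((8 * D : ℤ) : 𝓞 K)}) v ≠ 0 →
        a - 1 ∈ v.asIdeal ^ modulusExp (Ideal.span {((8 * D : ℤ) : 𝓞 K)}) v) ∧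
      LFunctions.idealPow K
          (fun v => (e (quarticResidueSymbol v (Ideal.Quotient.mk v.asIdeal (D : 𝓞 K)) ^ 3) : ℂ) *
            e (primaryGen (exists_units_mul_sub_one_mem_span_four hζ) v)) (Ideal.span {a}) ≠ e (a : K) := by
  classical
  obtain ⟨k, m, hDk, hpm⟩ := int_exists_eq_pow_mul_not_dvd hD hp
  obtain ⟨hk1, hk3⟩ := exponent_mem_of_dvd_of_not_pow_four_dvd hDk hpm hpD hD4
  have hm0 : m ≠ 0 := fun h => hD (by rw [hDk, h, mul_zero])
  have hp2 : p ≠ 2 := by rintro rfl; norm_num at hp1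
  have h2w := two_not_mem_of_natCast_mem_of_ne_two hp hp2 hw
  obtain ⟨σ, hσ⟩ := exists_algEquiv_ne_one_four (K := K)
  set τ := galRestrict ℤ ℚ K (𝓞 K) σ with hτ
  obtain ⟨π, hπ, hpπ, hne⟩ := exists_prime_eq_mul_galRestrict_of_mod_four_eq_one hσ hp hp1
  rw [← hτ] at hpπ hne
  -- the two primes above `p`: `π₁ ∈ 𝔭_w` and the other one `π₂`
  have hmax : ∀ {q : 𝓞 K}, Prime q → q ∈ w.asIdeal → w.asIdeal = Ideal.span {q} := fun {q} hq hqw =>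
    ((Ideal.IsPrime.isMaximal ((Ideal.span_singleton_prime hq.ne_zero).mpr hq)
      (by rw [Ne, Ideal.span_singleton_eq_bot]; exact hq.ne_zero)).eq_of_le w.isPrime.ne_top
      ((Ideal.span_singleton_le_iff_mem _).mpr hqw)).symm
  obtain ⟨π₁, π₂, hπ₁, hπ₂, hp12, hw1, hne12⟩ : ∃ π₁ π₂ : 𝓞 K, Prime π₁ ∧ Prime π₂ ∧ (p : 𝓞 K) = π₁ * π₂ ∧
      w.asIdeal = Ideal.span {π₁} ∧ Ideal.span {π₁} ≠ Ideal.span {π₂} := by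
    have hτπ : Prime (τ π) := (MulEquiv.prime_iff (τ : 𝓞 K ≃* 𝓞 K)).mpr hπ
    have hw' := hw
    rw [hpπ] at hw'
    rcases w.isPrime.mem_or_mem hw' with h | h
    · exact ⟨π, τ π, hπ, hτπ, hpπ, hmax hπ h, hne⟩
    · exact ⟨τ π, π, hτπ, hπ, by rw [hpπ, mul_comm], hmax hτπ h, hne.symm⟩
  let w' : HeightOneSpectrum (𝓞 K) := ⟨Ideal.span {π₂}, (Ideal.span_singleton_prime hπ₂.ne_zero).mpr hπ₂,
    by rw [Ne, Ideal.span_singleton_eq_bot]; exact hπ₂.ne_zero⟩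
  have hw'1 : w'.asIdeal = Ideal.span {π₂} := rfl
  have hw'ne : w' ≠ w := fun h => hne12 (by rw [← hw1, ← h])
  have hpw' : (p : 𝓞 K) ∈ w'.asIdeal := by
    rw [hw'1, hp12]; exact Ideal.mul_mem_left _ _ (Ideal.mem_span_singleton_self _)
  have h2w' := two_not_mem_of_natCast_mem_of_ne_two hp hp2 hpw'
  refine exists_quarticTwist_witness_of_factorisation hζ e hm0 hDk hk1 hk3 h2w
    (J := Ideal.span {((8 * m : ℤ) : 𝓞 K)} * w'.asIdeal ^ k) Ideal.mul_le_right ?_ ?_ ?_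
  · refine IsCoprime.mul_left (isCoprime_span_eight_mul_asIdeal hp hp2 hpm hw) (IsCoprime.pow_left ?_)
    exact Ideal.isCoprime_iff_sup_eq.mpr (w'.isMaximal.coprime_of_ne w.isMaximal fun h => hw'ne (HeightOneSpectrum.ext h))
  · rw [hw1, hw'1, mul_assoc, ← mul_pow, Ideal.span_singleton_mul_span_singleton, Ideal.span_singleton_pow,
      Ideal.span_singleton_mul_span_singleton, hDk]
    congr 1; push_cast; rw [hp12]; ring
  · intro a ha1 haw
    have ha8m : a - 1 ∈ Ideal.span {((8 * m : ℤ) : 𝓞 K)} := Ideal.mul_le_right ha1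
    have haw' : a - 1 ∈ w'.asIdeal := (Ideal.mul_le_left.trans (Ideal.pow_le_self (by omega))) ha1
    have ha4 : a - 1 ∈ Ideal.span {(2 + 2 * ζ : 𝓞 K)} := QuarticTwistDatum.span_le_span_two_add hζ m ha8m
    have hnot2 : a ∉ w'.asIdeal := fun h => w'.isPrime.ne_top ((Ideal.eq_top_iff_one _).mpr
      (by simpa using w'.asIdeal.sub_mem h haw'))
    have hcop1 : IsCoprime a π₁ :=
      ((Prime.coprime_iff_not_dvd hπ₁).mpr fun h => haw (hw1 ▸ Ideal.mem_span_singleton.mpr h)).symm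
    have hcop2 : IsCoprime a π₂ :=
      ((Prime.coprime_iff_not_dvd hπ₂).mpr fun h => hnot2 (hw'1 ▸ Ideal.mem_span_singleton.mpr h)).symm
    have hcop : IsCoprime a (p : 𝓞 K) := by rw [hp12]; exact hcop1.mul_right hcop2
    have hrec := quarticSymbol_span_intCast_primary_comm hζ (a := (p : ℤ)) (by omega) ha4 (by push_cast; exact hcop)
    push_cast at hrec
    have h1 : Ideal.span {π₁} ≠ ⊥ := by rw [Ne, Ideal.span_singleton_eq_bot]; exact hπ₁.ne_zero
    have h2 : Ideal.span {π₂} ≠ ⊥ := by rw [Ne, Ideal.span_singleton_eq_bot]; exact hπ₂.ne_zero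
    rw [← hrec, hp12, ← Ideal.span_singleton_mul_span_singleton, quarticSymbol_mul h1 h2, ← hw1, ← hw'1,
      quarticSymbol_asIdeal, quarticSymbol_asIdeal, quarticResidueSymbol_mk_eq_mk_of_sub_mem w' haw', map_one,
      quarticResidueSymbol_one hζ h2w', mul_one]

end WitnessOdd

/-! ### §6 The ramification witness above every prime of `2D` -/

section Witness

variable [IsPrincipalIdealRing (𝓞 K)]
include hζ

/-- **Ramification witnesses for `χ_D` at every prime `𝔭_w ∣ 2D`** (`D ≠ 0`, `p⁴ ∤ D` for the prime `p` below `𝔭_w`):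
an integer `a ∉ 𝔭_w`, prime to `8D`, `≡ 1` modulo the prime-power factors of `(8D)` away from `𝔭_w`, on which the ideal
character `χ̃_D((a)) = e((D/(a))₄³ · ã)` differs from `e(a)` — so `χ_D` is not trivial on the local units at `𝔭_w`:
«if `P` divides `2D` define `χ(P) = 0`» (the places `P ∣ 2D` divide the conductor of `χ_D`).
[cite: IrelandRosen1982, Ch. 18 §6, Theorem 7; Ch. 9 §§8–9] -/
theorem exists_quarticTwist_witness (e : K →+* ℂ) {D : ℤ} (hD : D ≠ 0) {p : ℕ} (hp : p.Prime)
    (hpD : (p : ℤ) ∣ 2 * D) (hD4 : ¬ (p : ℤ) ^ 4 ∣ D) {w : HeightOneSpectrum (𝓞 K)} (hw : (p : 𝓞 K) ∈ w.asIdeal) :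
    ∃ a : 𝓞 K, a ≠ 0 ∧ a ∉ w.asIdeal ∧ IsCoprime (Ideal.span {a}) (Ideal.span {((8 * D : ℤ) : 𝓞 K)}) ∧
      (∀ v : HeightOneSpectrum (𝓞 K), v ≠ w → modulusExp (Ideal.span {((8 * D : ℤ) : 𝓞 K)}) v ≠ 0 →
        a - 1 ∈ v.asIdeal ^ modulusExp (Ideal.span {((8 * D : ℤ) : 𝓞 K)}) v) ∧
      LFunctions.idealPow K
          (fun v => (e (quarticResidueSymbol v (Ideal.Quotient.mk v.asIdeal (D : 𝓞 K)) ^ 3) : ℂ) *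
            e (primaryGen (exists_units_mul_sub_one_mem_span_four hζ) v)) (Ideal.span {a}) ≠ e (a : K) := by
  by_cases hp2 : p = 2
  · subst hp2
    exact exists_quarticTwist_witness_two hζ e hD (by exact_mod_cast hw)
  · have hpD' : (p : ℤ) ∣ D := by
      rcases (Nat.prime_iff_prime_int.mp hp).dvd_or_dvd hpD with h | h
      · exact absurd ((Nat.prime_dvd_prime_iff_eq hp Nat.prime_two).mp (by exact_mod_cast h)) hp2
      · exact h
    have hodd : p % 2 = 1 := (hp.eq_two_or_odd).resolve_left hp2
    rcases (show p % 4 = 1 ∨ p % 4 = 3 by omega) with h1 | h3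
    · exact exists_quarticTwist_witness_split hζ e hD hp h1 hpD' hD4 hw
    · exact exists_quarticTwist_witness_inert hζ e hD hp h3 hpD' hD4 hw

end Witness

end Literature.NumberTheory.GaloisRepresentations

end
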